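import Summits.Ventures.PercRepro.ProfileUnicyclicCircuit

/-!
# PercRepro — THE CIRCUIT-MARKED CONJECTURE RESTRICTED TO THE BOTTOM LEVEL (p10, gen 10; `proofs/P10-AVFULL.md` §19(j))

ERRATUM to `UniCircLym` (ProfileUnicyclicCircuit): the all-levels statement `(n − k)·U^D_k ≤ k·U^D_{k+1}` for every
`2k + 1 ≤ n` is FALSE — for the parallel pair `D = {e, e'}` it is the `e`-marked Theorem A `(E)`, and `(E)` fails at
the middle level of `T = Θ_5 ⊕ U_{11,11}` (`n_T = 22`: the graphic matroid of the edge `e = uv` plus five paths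
`u–w_i–v`, with eleven coloops): `12·P^e_10 = 12·47520 = 570240 > 11·P^e_11 = 11·51744 = 569184` (direct
enumeration of the `2^22` subsets, mining/p10/g10/witness22.c; the family `Θ_t ⊕ U_{c,c}`, theta.py).  The open
piece `(c)` only needs the BOTTOM level `k = n − ρ(E)` (the complement of `X` is a basis): that restriction,
`UniCircLymBottom`, survives every stress applied (all matroids on `≤ 9` elements, random matroids on `10 … 13`,
`T ⊕ U_{c,c}` for `c ≤ 20` on the whole `n = 9` catalogue — 34,371,637 instances, `T₁ ⊕ T₂` on 18 elements), and
is the conjecture of record from here on; it is a `Prop`, NOT asserted.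

* `UniCircLymBottom` (the DEF);
* **`uniLym_c_of_uniCircLymBottom`** (`UniCircLymBottom α → (c)` on every `M` with `#E = ρ + q + 1`, `q + 2 ≤ ρ`);
* `uniCircLymBottom_of_uniCircLym` (the all-levels statement implies the bottom one — recorded for the dependency
  graph only; the all-levels statement is false).
-/

open scoped Matroid

namespace PercRepro.Cogirth

open Finset ThmH Skew Shadow Profile

variable {α : Type} [DecidableEq α]

/-- **THE CIRCUIT-MARKED UNICYCLIC LYM CONJECTURE AT THE BOTTOM LEVEL** (a `Prop`; NOT asserted): for every finite
matroid on `n` elements of rank `ρ` with `2(n − ρ) + 1 ≤ n`, and every `D ⊆ E`, `ρ·U^D_{n−ρ} ≤ (n − ρ)·U^D_{n−ρ+1}` —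
the unicyclic sets with circuit `D` whose complement is a basis, against those whose complement is independent of
co-size one.  For a loop `D = {e}` it is Theorem A (Brändén–Huh) for `M ∖ e` at its bottom level
(`uniCircLym_loop`); for a parallel pair it is the bottom instance of `(E)` (`markedLym_iff_uniCircLym_parallel`). -/
def UniCircLymBottom (α : Type) [DecidableEq α] : Prop :=
  ∀ (M : Matroid α) [M.Finite] (D : Finset α), 2 * ((gr M).card - rk M (gr M)) + 1 ≤ (gr M).card →
    rk M (gr M) * (uniIndepSetsCirc M D ((gr M).card - rk M (gr M))).card ≤
      ((gr M).card - rk M (gr M)) * (uniIndepSetsCirc M D ((gr M).card - rk M (gr M) + 1)).card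

/-- The all-levels statement implies the bottom one (the former is false; kept for the dependency graph). -/
theorem uniCircLymBottom_of_uniCircLym (h : UniCircLym α) : UniCircLymBottom α := by
  intro M _ D hk
  have h1 := h M D ((gr M).card - rk M (gr M)) hk
  have hle : rk M (gr M) ≤ (gr M).card := rk_le_card' (gr M)
  have e : (gr M).card - ((gr M).card - rk M (gr M)) = rk M (gr M) := by omega
  rw [e] at h1
  exact h1

/-- **THE BRIDGE**: the bottom-level conjecture, summed over the circuits, is the open piece `(c)` of the top-but-one
level on `#E = ρ + q + 1`: `ρ·U_{q+1} ≤ (q+1)·U_{q+2}`. -/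
theorem uniLym_c_of_uniCircLymBottom (h : UniCircLymBottom α) (M : Matroid α) [M.Finite] {q : ℕ}
    (hn : (gr M).card = rk M (gr M) + q + 1) (hq : q + 2 ≤ rk M (gr M)) :
    rk M (gr M) * (uniIndepSets M (q + 1)).card ≤ (q + 1) * (uniIndepSets M (q + 2)).card := by
  rw [card_uniIndepSets_eq_sum M (q + 1), card_uniIndepSets_eq_sum M (q + 2), mul_sum, mul_sum]
  apply sum_le_sum
  intro D _
  have h1 := h M D (by omega)
  have e : (gr M).card - rk M (gr M) = q + 1 := by omega
  rw [e] at h1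
  exact h1

end PercRepro.Cogirth
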